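import Literature.IUT.LogVolume.Corollary22Statement
import Literature.IUT.LogVolume.PrimeNumberEstimates
import Literature.NumberTheory.DiophantineGeometry.GenEllFullGalois
import Literature.NumberTheory.EllipticCurves.LegendreFormGoodModelProofs
import HarnessLib

/-!
# [IUTchIV] Corollary 2.2 (ii): the Legendre family — what the proof of (ii) CONSUMES from
# Theorem 1.10, and the classical Galois-image input, as two named interfaces

Mochizuki, *Inter-universal Teichmüller theory IV*, RIMS manuscript (Apr. 2020; = PRIMS **57** (2021)),
Cor. 2.2, statement pp. 41–43, proof of (ii) pp. 43–48; Thm. 1.10, statement pp. 22–23. TAKES NO SIDE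
on the disputed step: Theorem 1.10 rests on [IUTchIII] Cor. 3.12 and enters below only as the
HYPOTHESIS `Thm110Legendre` (a `Prop`, never asserted); nothing is asserted about any elliptic curve.

The proof of Cor. 2.2 (ii) (pp. 43–48) attaches to a point `x_E = λ ∈ U_X(F_tpd)` of the `λ`-line
(`F_tpd = ℚ(λ)`, p. 42/48: "`log-diff_X(x_E) = log(𝔡^{F_tpd})`") the Legendre curve
`E : y² = x(x−1)(x−λ)`, the number field `F := F_tpd(√−1, E_{F_tpd}[3·5])` (p. 42), and a prime `l`
chosen by Prop. 2.1 (ii) with (P1)–(P3) (p. 45); after discarding finitely many points (the curves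
without `F`-core, p. 43; `h^{1/2} < ξ_prm`, p. 44; (P4) p. 45; (P5) p. 46; `ε_E > 1`, p. 47) it asserts
(p. 46): "it follows formally from (P1), (P2), (P5), and (P6) that … there exist data `C̲_K`, `V̲`, `ε̲`
such that all of the conditions of [IUTchI], Definition 3.1, (a)–(f), are satisfied, and … (P7) the
resulting initial Θ-data … satisfies the various conditions in the statement of Theorem 1.10. … In light
of (P7), we may apply Theorem 1.10 to conclude that
`(1/6)·log(q) ≤ (1 + 20·d_mod/l)·(log(𝔡^{F_tpd}) + log(𝔣^{F_tpd})) + 20·(d*_mod·l + η_prm)`".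

This file types, over the tree's `λ`-line vocabulary (`NFPoint`, `Cor22.jInv`, `Cor22.logQAvoid`, …):
* `IsThetaField P F` — "`F = F_tpd(√−1, E_{F_tpd}[3·5])`" for the point `P = (F_tpd, λ)` (p. 42; Thm.
  1.10 p. 22), as a predicate on a number field `F ⊇ F_tpd` (any two such `F` are `F_tpd`-isomorphic);
  `thetaEllPoint P hU F` — the curve `E_F` as a presented point of `M_ell` ([GenEll] §3 vocabulary
  `EllPoint` of `GenEllMell.lean`; the Weierstrass literal `⟨0, −(1+λ), 0, λ, 0⟩` of the tree's Legendre
  files, `NFPoint.legendreCurve` in `GenEllRemarks44.lean`);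
* `dmod P = d_mod := [F_mod : ℚ]`, `F_mod = ℚ(j(λ))` (Thm. 1.10 p. 22; [IUTchI] Def. 3.1 (b), the tree's
  `fieldOfModuli` design choice); `logCondAvoid P S` = "`log(𝔣^{F_tpd})`" (p. 23: the reduced divisor
  with the support of the `q`-parameter divisor) away from the primes in `S`; the four `j`-invariants of
  the curves without core (`coreExceptionalJ`, p. 43 "[cf. [CanLift], Proposition 2.7]");
* the conditions (P2), (P5), (P6) of pp. 45–46 as predicates `CondP2`, `CondP5`, `CondP6`;
* **`Thm110Legendre`** — the displayed consequence of Theorem 1.10 quoted above, for every `P ∈ U_X`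
  presented minimally, every prime `l ≥ 5` and every `η_prm` as in Prop. 1.6, under (P2), (P5), (P6) and
  "`E` admits an `F`-core" — i.e. exactly what the proof of (ii) takes from Thm. 1.10 INCLUDING the
  existence assertion (P7). This is the interface the campaign on [IUTchI–III] must deliver; here it is
  a HYPOTHESIS. The printed display has `e*_mod`; p. 46 l. 1 applies it with `e*_mod ≤ d*_mod`, which is
  the form typed (so `Thm110Legendre` is implied by the printed Theorem 1.10 for these Θ-data).
* **`FullGaloisImage`** — the CLASSICAL input (P4) ⇒ (P6) of pp. 45–46 ("the existence of an `l`-cyclic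
  subgroup scheme of `E_F` would imply that … `log(q^∀)` is bounded" by [GenEll] Lem. 3.5, Prop. 3.4 and
  (i); "(P6) follows formally from (P2), (P4), and [GenEll], Lemma 3.1, (iii)"): on a compactly bounded
  `K_V`, for `h = log(q^∀)` above a constant depending only on `K_V`, (P2) and (P5) give (P6). A named
  classical interface, dischargeable from the tree's `GenEll_lemma35` (named fact), `prop34Ineq_of_pos`,
  `Cor22.partI_holds`, the Tate-curve transvection and `GenEll_lemma31_iii` — not proved in this file.

Companion (proof) files derive `Cor22.PartII` — hence `Cor22.Corollary22` — from these two interfaces.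
Deliberately NOT here: any construction of `F`, `K`, or of initial Θ-data; any proof.
-/

noncomputable section

namespace Literature.IUT.LogVolume

namespace Cor22

open NumberField IsDedekindDomain Literature.NumberTheory.DiophantineGeometry.GenEll
open Literature.NumberTheory.EllipticCurves

/-! ## The point `λ` over an extension field; the curve `E_F` -/

/-- The point `λ ∈ U_X(F_tpd)` regarded as a point over a finite extension `F ⊇ F_tpd` ("`x_E ∈ U_X(F_tpd)
⊆ U_X(F)`", p. 42): same coordinate, presented over `F`. [claim: Mochizuki2012, status: disputed] -/
def extend (P : NFPoint) (F : Type) [Field F] [NumberField F] [Algebra P.F F] : NFPoint where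
  F := F
  x := algebraMap P.F F P.x

/-- `λ ≠ 0, 1` is preserved under field extension. [claim: Mochizuki2012, status: disputed] -/
theorem extend_inU {P : NFPoint} (hU : P.InU) (F : Type) [Field F] [NumberField F] [Algebra P.F F] :
    (extend P F).InU := by
  refine ⟨fun h => hU.1 ?_, fun h => hU.2 ?_⟩
  · exact (map_eq_zero_iff _ (algebraMap P.F F).injective).1 h
  · exact (map_eq_one_iff _ (algebraMap P.F F).injective).1 h

/-- The Legendre curve `E_F : y² = x(x−1)(x−λ)` over `F ⊇ F_tpd` ("a model `E_{F_tpd}` of the elliptic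
curve `E_F ×_F ℚ̄` over `F_tpd` determined by the Legendre form of the Weierstrass equation", p. 42), as the
Weierstrass curve `⟨0, −(1+λ), 0, λ, 0⟩` over `F` (the literal of the tree's Legendre files, e.g.
`NFPoint.legendreCurve`; here for the extended point). [claim: Mochizuki2012, status: disputed] -/
abbrev thetaCurve (P : NFPoint) (F : Type) [Field F] [NumberField F] [Algebra P.F F] :
    WeierstrassCurve F :=
  ⟨0, -(1 + algebraMap P.F F P.x), 0, algebraMap P.F F P.x, 0⟩

/-- `E_F` is an elliptic curve for `λ ∈ U_X` (`Δ = 16λ²(λ−1)² ≠ 0`; the tree's `legendre_isElliptic_iff`).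
[claim: Mochizuki2012, status: disputed] -/
theorem thetaCurve_isElliptic {P : NFPoint} (hU : P.InU) (F : Type) [Field F] [NumberField F]
    [Algebra P.F F] : (thetaCurve P F).IsElliptic :=
  (legendre_isElliptic_iff (F := F) two_ne_zero (algebraMap P.F F P.x)).2 (extend_inU hU F)

/-- `E_F` as a presented point `[E_F] ∈ M_ell(ℚ̄)` over `F` ([GenEll] §3 vocabulary `EllPoint`), for
`λ ∈ U_X`. [claim: Mochizuki2012, status: disputed] -/
def thetaEllPoint (P : NFPoint) (hU : P.InU) (F : Type) [Field F] [NumberField F] [Algebra P.F F] :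
    EllPoint :=
  @EllPoint.mk F _ _ (thetaCurve P F) (thetaCurve_isElliptic hU F)

/-- The coordinates `{x, y}` of an affine point of a Weierstrass curve (`∅` for the origin): "the fields
of definition of the … torsion points" (p. 42) are generated by these. [claim: Mochizuki2012, status: disputed] -/
def pointCoords {F : Type} [Field F] {W : WeierstrassCurve F} : W.toAffine.Point → Set F
  | .zero => ∅
  | .some x y _ => {x, y}

open scoped Classical in
/-- The coordinates of the `F`-rational `(3·5)`-torsion points of `E_F`. [claim: Mochizuki2012, status: disputed] -/
def torsionCoords (P : NFPoint) (F : Type) [Field F] [NumberField F] [Algebra P.F F] : Set F :=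
  ⋃ T ∈ {T : (thetaCurve P F).toAffine.Point | (15 : ℤ) • T = 0}, pointCoords T

/-- **"`F = F_tpd(√−1, E_{F_tpd}[3·5])`"** (Cor. 2.2 (ii) p. 42; Thm. 1.10 p. 22: "we assume that the
`(3·5)`-torsion points of `E_F` are defined over `F`, and that `F = F_mod(√−1, E_{F_mod}[2·3·5]) =
F_tpd(√−1, E_{F_tpd}[3·5])` — i.e., that `F` is obtained from `F_tpd` by adjoining `√−1`, together with
the fields of definition of the `(3·5)`-torsion points of a model `E_{F_tpd}` … determined by the Legendre
form"), as a predicate on a number field `F ⊇ F_tpd = P.F`: `√−1 ∈ F`; every geometric `15`-torsion point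
of `E_F` is fixed by `Gal(F̄/F)` (i.e. is `F`-rational); and `F` is generated over `F_tpd` by `±√−1` and
the coordinates of the `15`-torsion points. The last three clauses RECORD classical consequences that the
text uses and that the constructor of such an `F` establishes (they are part of the datum here so that
consumers need not re-derive them): `F/F_tpd` is Galois and "`Gal(F/F_tpd) ↪ GL₂(𝔽₃) × GL₂(𝔽₅) × ℤ/2ℤ`"
(Thm. 1.10, Step (ii), p. 24), whence `[F : F_tpd] ∣ 2·48·480 = 46080`; and "it follows from Proposition
1.8, (v), that `E_F` has stable reduction at every element of `𝕍(F)^non`" (p. 42) — semistable reduction,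
the tree's `WeierstrassCurve.IsSemistable`. [claim: Mochizuki2012, status: disputed] -/
structure IsThetaField (P : NFPoint) (F : Type) [Field F] [NumberField F] [Algebra P.F F] : Prop where
  /-- `√−1 ∈ F` -/
  sqrt_neg_one : ∃ i : F, i ^ 2 = -1
  /-- the `(3·5)`-torsion points of `E_F` are defined over `F`: `Gal(F̄/F)` fixes `E_F[15](F̄)` -/
  torsion_rational : ∀ σ : Field.absoluteGaloisGroup F, ∀ T : WeierstrassCurve.geomPoints (thetaCurve P F),
    (15 : ℤ) • T = 0 → σ • T = T
  /-- `F` is generated over `F_tpd` by `√−1` and the coordinates of the `15`-torsion points -/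
  adjoin_eq_top : IntermediateField.adjoin P.F ({i : F | i ^ 2 = -1} ∪ torsionCoords P F) = ⊤
  /-- (recorded consequence) `F/F_tpd` is Galois -/
  isGalois : IsGalois P.F F
  /-- (recorded consequence) `[F : F_tpd]` divides `|ℤ/2ℤ × GL₂(𝔽₃) × GL₂(𝔽₅)| = 2·48·480` -/
  finrank_dvd : Module.finrank P.F F ∣ 46080
  /-- (recorded consequence, Prop. 1.8 (v)) `E_F` has semistable reduction at every finite place of `F` -/
  isSemistable : (thetaCurve P F).IsSemistable (𝓞 F)

/-! ## The quantities of the display -/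

/-- `d_mod := [F_mod : ℚ]` (Thm. 1.10, p. 22) with `F_mod = ℚ(j(λ))` "the field of moduli" ([IUTchI] Def.
3.1 (b); [IUTchIV] Prop. 1.8 (ii): "the field generated over `k` by the `j`-invariant"; the tree's
`fieldOfModuli` takes `ℚ(j_E)` as the definition) — the degree of the subfield `ℚ(j(λ)) ⊆ F_tpd`.
[claim: Mochizuki2012, status: disputed] -/
def dmod (P : NFPoint) : ℕ :=
  Module.finrank ℚ (IntermediateField.adjoin ℚ ({jInv P.x} : Set P.F))

open scoped Classical in
/-- The reduced divisor `𝔣` of the `q`-parameter divisor away from `S`: "the effective arithmetic divisor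
whose support coincides with `Supp(𝔮)`, but all of whose coefficients are equal to `1` — i.e., the
conductor" (p. 23), restricted like `qDivisor` to the bad places not dividing the primes in `S`.
[claim: Mochizuki2012, status: disputed] -/
def condDivisor (P : NFPoint) (S : Finset ℕ) : FinDivisor P.F :=
  ∑ v ∈ (badPlaces P).filter (fun v => ∀ p ∈ S, ((p : ℕ) : 𝓞 P.F) ∉ v.asIdeal), FinDivisor.of v 1

/-- `log(𝔣^{F_tpd})` for `𝕍^bad_mod` = the bad places not dividing the primes in `S` (p. 23:
"`log(𝔣^F) := deg(𝔣^F_ADiv)`"; (P5) p. 46: `S = {2, l}`): the normalized degree of `condDivisor`.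
[claim: Mochizuki2012, status: disputed] -/
def logCondAvoid (P : NFPoint) (S : Finset ℕ) : ℝ := FinDivisor.ndeg P.F (condDivisor P S)

/-- The four `j`-invariants of the once-punctured elliptic curves in characteristic `0` that fail to admit
a core (p. 43: "if the once-punctured elliptic curve associated to `E_F` fails to admit an `F`-core, then
there are only four possibilities for the `j`-invariant of `E_F` [cf. [CanLift], Proposition 2.7]"):
`2^{14}·31^3·5^{−3} = 488095744/125`, `2^2·73^3·3^{−4} = 1556068/81`, `2^6·3^3 = 1728`, `0` (the list as
printed in Mochizuki–Fesenko–Hoshi–Minamide–Porowski, *Explicit estimates in inter-universal Teichmüller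
theory*, Prop. 2.1, citing [Sijs] Table 4 and [CanLift] Prop. 2.7). [claim: Mochizuki2012, status: disputed] -/
def coreExceptionalJ : Finset ℚ := {488095744 / 125, 1556068 / 81, 1728, 0}

/-- "The once-punctured elliptic curve associated to `E_F` admits an `F`-core" in the form the proof uses
it (p. 43): `j(λ)` is none of the four exceptional values. [claim: Mochizuki2012, status: disputed] -/
def AdmitsCore (P : NFPoint) : Prop := ∀ q ∈ coreExceptionalJ, jInv P.x ≠ (q : P.F)

/-! ## The conditions (P2), (P5), (P6) of the proof of Cor. 2.2 (ii) (pp. 45–46) -/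

/-- **(P2)** (p. 45): "`l` does not divide any nonzero `h_v`", `h_v` the local height of `E` at the finite
place `v` (p. 44; = the order of the `q`-parameter = `−ord_v(j)` at a place of multiplicative reduction,
[GenEll] Def. 3.3 / Rmk. 3.3.1), stated over `F_tpd` through `ord_v(j(λ))` like `Cor22.localHeight`:
`l ∤ ord_v(j(λ))` whenever `ord_v(j(λ)) < 0`. (Over `F = F_tpd(√−1, E[3·5])` the local heights get
multiplied by ramification indices dividing `[F : F_tpd] ∣ 46080 = 2^{10}·3^2·5`, so for `l ≥ 7` the
condition over `F` and over `F_tpd` agree; this is also [IUTchI] Def. 3.1 (c) "`l` prime to the orders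
of the `q`-parameters".) [claim: Mochizuki2012, status: disputed] -/
def CondP2 (P : NFPoint) (l : ℕ) : Prop :=
  ∀ v : HeightOneSpectrum (𝓞 P.F), ord P.F v (jInv P.x) < 0 → ¬ ((l : ℤ) ∣ ord P.F v (jInv P.x))

/-- **(P5)** (p. 46): "`𝕍^bad_mod := ` the nonarchimedean valuations of `F_mod` that do not divide `2l` and at
which `E_F` has bad multiplicative reduction; then `𝕍^bad_mod ≠ ∅`" — there is a finite place of `F_tpd`
not dividing `2l` at which `ord(j(λ)) < 0` (potentially multiplicative, hence — `E_F` being semistable —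
multiplicative reduction over `F`). [claim: Mochizuki2012, status: disputed] -/
def CondP5 (P : NFPoint) (l : ℕ) : Prop :=
  ∃ v : HeightOneSpectrum (𝓞 P.F), ord P.F v (jInv P.x) < 0 ∧
    ((2 : ℕ) : 𝓞 P.F) ∉ v.asIdeal ∧ ((l : ℕ) : 𝓞 P.F) ∉ v.asIdeal

/-- **(P6)** (p. 46): "the image of the outer homomorphism `Gal(ℚ̄/F) → GL₂(𝔽_l)` determined by the
`l`-torsion points of `E_F` contains the subgroup `SL₂(𝔽_l) ⊆ GL₂(𝔽_l)`" ([IUTchI] Def. 3.1 (c)), for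
`F = F_tpd(√−1, E[3·5])`: stated for every theta-field `F` of `P` (they are `F_tpd`-isomorphic) in the
[GenEll] §3 form `EllPoint.ImageModLContainsSL2` (every determinant-one `𝔽_l`-endomorphism of `E_F[l](F̄)`
is a Galois element). [claim: Mochizuki2012, status: disputed] -/
def CondP6 (P : NFPoint) (l : ℕ) : Prop :=
  ∀ (hU : P.InU) (F : Type) [Field F] [NumberField F] [Algebra P.F F], IsThetaField P F →
    ∀ [NeZero l], (thetaEllPoint P hU F).ImageModLContainsSL2 l

/-! ## The two interfaces -/

/-- The display as applied on p. 46 l. 1 for the point `P = (F_tpd, λ)`, the prime `l` and `η_prm`: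
`(1/6)·log(q) ≤ (1 + 20·d_mod/l)·(log(𝔡^{F_tpd}) + log(𝔣^{F_tpd})) + 20·(d*_mod·l + η_prm)` with
`log(q) = log(q^{∤{2,l}}(λ))` ((P5): `𝕍^bad_mod` = the bad places not dividing `2l`; the tree's
`logQAvoid`), `log(𝔡^{F_tpd}) = log-diff_X(x_E)` (p. 43; the tree's `NFPoint.logDiff` of the minimally
presented point), `log(𝔣^{F_tpd}) = logCondAvoid P {2,l}`, `d*_mod = 2^{12}·3^3·5·d_mod` (p. 22).
[claim: Mochizuki2012, status: disputed] -/
def Display (P : NFPoint) (l : ℕ) (η : ℝ) : Prop :=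
  1 / 6 * logQAvoid P {2, l} ≤
    (1 + 20 * (dmod P : ℝ) / l) * (P.logDiff + logCondAvoid P {2, l})
      + 20 * (2 ^ 12 * 3 ^ 3 * 5 * (dmod P : ℝ) * l + η)

/-- **What the proof of Cor. 2.2 (ii) takes from [IUTchIV] Theorem 1.10** (p. 46: "it follows formally from
(P1), (P2), (P5), and (P6) that, if one takes … “`F`” to be the number field `F` …, “`X_F`” to be the
once-punctured elliptic curve associated to `E_F`, “`l`” to be the prime number `l` …, and “`𝕍^bad_mod`” to
be the set `𝕍^bad_mod` of (P5), then there exist data “`C̲_K`”, “`𝕍̲`”, and “`ε̲`” such that all of the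
conditions of [IUTchI], Definition 3.1, (a), (b), (c), (d), (e), (f), are satisfied, and … (P7) … In light
of (P7), we may apply Theorem 1.10 [cf. also Remark 1.10.7, (i)] to conclude that `(1/6)·log(q) ≤ (1 +
20·d_mod/l)·(log(𝔡^{F_tpd}) + log(𝔣^{F_tpd})) + 20·(d*_mod·l + η_prm)`"), under "the once-punctured elliptic
curve associated to `E_F` admits an `F`-core" (p. 43): for every `η_prm` as in Prop. 1.6 (`IsEtaPrm`),
every `λ ∈ U_X` presented over its minimal field `F_tpd = ℚ(λ)`, every prime `l ≥ 5` ([IUTchI] Def. 3.1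
(c); `l ≠ 5` then follows as on p. 22, (P6) failing at `l = 5` since `E[5] ⊆ E(F)`), (P2), (P5), (P6) imply
the display. HYPOTHESIS — the statement rests on Theorem 1.10, hence on [IUTchIII] Cor. 3.12; it is the
interface to be delivered by the formalisation of [IUTchI–III]; never asserted here.
[claim: Mochizuki2012, status: disputed] -/
def Thm110Legendre : Prop :=
  ∀ η : ℝ, IsEtaPrm η → ∀ P : NFPoint, P ∈ UP → ∀ l : ℕ, l.Prime → 5 ≤ l →
    AdmitsCore P → CondP2 P l → CondP5 P l → CondP6 P l → Display P l η

/-- **The classical Galois-image input of the proof of Cor. 2.2 (ii), (P4) ⇒ (P6)** (pp. 45–46): "by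
possibly enlarging the finite set `Exc_d` [… in such a way that `h ≤ H_K` on `Exc_d` for some positive real
number `H_K` that depends only on `K_V`], we may assume … (P4) `E_F` does not admit an `l`-cyclic subgroup
scheme. Indeed, the existence of an `l`-cyclic subgroup scheme of `E_F` would imply that
`((l−2)/24)·log(q^∀) ≤ 2·log(l) + T_K` [(i), (P2), [GenEll] Lem. 3.5, Prop. 3.4] … hence that … `log(q^∀)`
is bounded" and "(P6) follows formally from (P2), (P4), and [GenEll], Lemma 3.1, (iii)" [given the
multiplicative place of (P5)]: for every compactly bounded `K_V` satisfying the hypotheses of Cor. 2.2 there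
is `H_K` such that for `λ ∈ K_V ∩ U_X` (minimally presented), primes `l ≥ 7` with (P2), (P5), and
`h = log(q^∀(λ)) > H_K`, condition (P6) holds. On `l ≥ 7`: the prime of (P1) exceeds `h^{1/2} ≥ ξ_prm ≥ 5`
(p. 45, (S1): all primes `≤ h^{1/2}` are excluded), so `l ≥ 7` there; and `l ∉ {2, 3, 5}` is NEEDED for
the statement to be true — `[F : F_tpd]` divides `2^{10}·3^2·5` (so (P2) over `F_tpd` gives (P2) over `F`
exactly for such `l`), and at `l = 5` the image on `E[5] ⊆ E(F)` is trivial (Thm. 1.10, p. 22: "`l ≠ 5`").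
CLASSICAL (no Θ-data occur): to be discharged from the tree's named fact `GenEll_lemma35`,
`prop34Ineq_of_pos`, `Cor22.partI_holds`, the Tate-curve transvection and `GenEll_lemma31_iii`; a
hypothesis of the companion proof file until then. [claim: Mochizuki2012, status: disputed] -/
def FullGaloisImage : Prop :=
  ∀ D : CBData, Hypotheses D → ∃ HK : ℝ, ∀ P : NFPoint, P ∈ D.toSet → P ∈ UP →
    ∀ l : ℕ, l.Prime → 7 ≤ l → CondP2 P l → CondP5 P l → HK < logQForall P → CondP6 P l

end Cor22

end Literature.IUT.LogVolume

end
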